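import Mathlib
import Summits.NavierStokesRegularity.NavierStokesRegularity.Theorems.SubOnsagerCeilingDefs
import Summits.NavierStokesRegularity.NavierStokesRegularity.Theorems.OrthantWakeOrthantTableStructure
import Literature.Analysis.FluidPDE.Tao2016AveragedNS.RenormalisedCascadeWaves
import HarnessLib

/-!
# Route SubOnsagerCeiling — the side-branch dead-end table `α_SB` is an ORTHANT table of `E₂(10)`
(helper file for item stmt-NavierStokesRegularity-25507 `SubOnsagerCeiling.OrthantTailCeiling`; `--supports … --as helper`)

`sideBranchTable` (`Theorems/SubOnsagerCeilingDefs.lean`) is the lead's numerical WITNESS against the crux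
`OrthantTailCeiling` AS TYPED (evidence `Cruxes/OrthantTailCeiling/REFUTATION-EVIDENCE.md`: along its honest viscous
solutions the dead-end pockets park tail energy `≍ E₀(1+ε₀)^{−Θ n}`, `Θ → 5/9 < 1`, on a band of shells growing like
`ln(1/ν)`, so no `ν`-uniform `θ > 1/2` ceiling exists for it). This file checks, in the kernel, that the witness is
ADMISSIBLE for the crux: it satisfies every hypothesis the crux places on the table —

* `sideBranchTable_inTableClass : InTableClass 10 sideBranchTable` (symmetric (4.2), cancelling (4.3), `10`-comparable:
  moduli `≤ 1`, non-zero moduli `≥ 1/10`);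
* `sideBranchTable_orthant` : the orthant (Kamke) hypothesis of the crux, verbatim, via the tree's finite criterion
  `orthant_iff_coefficients` (feed forms `w₀²`, `w₁²/5` are `≥ 0` on `ℝ⁴`; no cross back-reactions; in-shell forms are
  the pump `0 → 1`).

So the only thing separating the numerical refutation from a Lean `¬OrthantTailCeiling` is certified control of the honest
solutions of this explicit 3-mode lattice at deep shells (a cascade analysis), not any ambiguity about the table.
Closed forms of the table on the four shifts are recorded first (`sideBranchTable_feed/_up1/_up2/_inshell`).

HONEST FRAMING: finite algebra about a Tao-type MODEL lattice table (route SubOnsagerCeiling, rung TL-M2Break); the crux is NOT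
refuted in Lean here; nothing bears on Navier–Stokes regularity.
-/

noncomputable section

-- the sub-problem namespace `NavierStokesRegularity.NavierStokesRegularity` is the tree's layout (D-0017)
set_option linter.dupNamespace false

namespace Summit.NavierStokesRegularity.NavierStokesRegularity.Theorems.SubOnsagerCeiling

open Literature.Analysis.FluidPDE.TaoCascade

/-- Closed form on the shift `(0,0,1)` (feeds): chain `1` on `(0,0,0)`, pocket `1/5` on `(1,1,2)`. [this file] -/
theorem sideBranchTable_feed (i₁ i₂ i₃ : Fin 4) :
    sideBranchTable i₁ i₂ i₃ ((0 : ℤ), (0 : ℤ), (1 : ℤ)) =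
      (if i₁ = 0 ∧ i₂ = 0 ∧ i₃ = 0 then (1 : ℝ) else 0) + (if i₁ = 1 ∧ i₂ = 1 ∧ i₃ = 2 then 1 / 5 else 0) := by
  simp [sideBranchTable, dyadicTable]

/-- Closed form on the shift `(1,0,0)` (back-reactions, first slot up). [this file] -/
theorem sideBranchTable_up1 (i₁ i₂ i₃ : Fin 4) :
    sideBranchTable i₁ i₂ i₃ ((1 : ℤ), (0 : ℤ), (0 : ℤ)) =
      (if i₁ = 0 ∧ i₂ = 0 ∧ i₃ = 0 then (-(1 / 2) : ℝ) else 0) + (if i₁ = 2 ∧ i₂ = 1 ∧ i₃ = 1 then -(1 / 10) else 0) := by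
  simp [sideBranchTable, dyadicTable]

/-- Closed form on the shift `(0,1,0)` (back-reactions, second slot up). [this file] -/
theorem sideBranchTable_up2 (i₁ i₂ i₃ : Fin 4) :
    sideBranchTable i₁ i₂ i₃ ((0 : ℤ), (1 : ℤ), (0 : ℤ)) =
      (if i₁ = 0 ∧ i₂ = 0 ∧ i₃ = 0 then (-(1 / 2) : ℝ) else 0) + (if i₁ = 1 ∧ i₂ = 2 ∧ i₃ = 1 then -(1 / 10) else 0) := by
  simp [sideBranchTable, dyadicTable]

/-- Closed form on the shift `(0,0,0)` (in-shell side pump). [this file] -/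
theorem sideBranchTable_inshell (i₁ i₂ i₃ : Fin 4) :
    sideBranchTable i₁ i₂ i₃ ((0 : ℤ), (0 : ℤ), (0 : ℤ)) =
      (if i₁ = 0 ∧ i₂ = 0 ∧ i₃ = 1 then (1 / 5 : ℝ) else 0) +
        (if ((i₁ = 0 ∧ i₂ = 1) ∨ (i₁ = 1 ∧ i₂ = 0)) ∧ i₃ = 0 then -(1 / 10) else 0) := by
  have hAB : ¬ ((i₁ = 0 ∧ i₂ = 0 ∧ i₃ = 1) ∧ (((i₁ = 0 ∧ i₂ = 1) ∨ (i₁ = 1 ∧ i₂ = 0)) ∧ i₃ = 0)) := by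
    rintro ⟨⟨-, -, h1⟩, -, h0⟩; rw [h1] at h0; exact absurd h0 (by decide)
  by_cases hA : (i₁ = 0 ∧ i₂ = 0 ∧ i₃ = 1) <;>
    by_cases hB : (((i₁ = 0 ∧ i₂ = 1) ∨ (i₁ = 1 ∧ i₂ = 0)) ∧ i₃ = 0)
  · exact absurd ⟨hA, hB⟩ hAB
  all_goals simp [sideBranchTable, dyadicTable, hA, hB]

/-- `α_SB` satisfies Tao's symmetry condition (4.2). [this file] -/
theorem sideBranchTable_symmetric : IsSymmetricCoeff sideBranchTable := by
  intro i₁ i₂ i₃ μ₁ μ₂ μ₃ hμ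
  rw [mem_shiftSet_iff] at hμ
  simp only [Prod.mk.injEq] at hμ
  rcases hμ with ⟨rfl, rfl, rfl⟩ | ⟨rfl, rfl, rfl⟩ | ⟨rfl, rfl, rfl⟩ | ⟨rfl, rfl, rfl⟩
  · simp only [sideBranchTable_inshell]
    fin_cases i₁ <;> fin_cases i₂ <;> fin_cases i₃ <;> simp
  · simp only [sideBranchTable_up1, sideBranchTable_up2]
    fin_cases i₁ <;> fin_cases i₂ <;> fin_cases i₃ <;> simp
  · simp only [sideBranchTable_up1, sideBranchTable_up2]
    fin_cases i₁ <;> fin_cases i₂ <;> fin_cases i₃ <;> simp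
  · simp only [sideBranchTable_feed]
    fin_cases i₁ <;> fin_cases i₂ <;> fin_cases i₃ <;> simp

/-- `α_SB` satisfies Tao's cancellation condition (4.3) (each Katz–Pavlović pair is energy-neutral). [this file] -/
theorem sideBranchTable_cancelling : IsCancellingCoeff sideBranchTable := by
  intro i₁ i₂ i₃ μ₁ μ₂ μ₃ hμ
  rw [mem_shiftSet_iff] at hμ
  simp only [Prod.mk.injEq] at hμ
  rcases hμ with ⟨rfl, rfl, rfl⟩ | ⟨rfl, rfl, rfl⟩ | ⟨rfl, rfl, rfl⟩ | ⟨rfl, rfl, rfl⟩ <;>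
    simp only [sideBranchTable_inshell, sideBranchTable_feed, sideBranchTable_up1, sideBranchTable_up2] <;>
    fin_cases i₁ <;> fin_cases i₂ <;> fin_cases i₃ <;> simp <;> norm_num

/-- `α_SB` is `10`-comparable: moduli `≤ 1`, non-zero moduli `≥ 1/10`. [this file] -/
theorem sideBranchTable_comparable : IsComparableCoeff 10 sideBranchTable := by
  intro i₁ i₂ i₃ μ hμ
  rw [mem_shiftSet_iff] at hμ
  rcases hμ with rfl | rfl | rfl | rfl <;>
    simp only [sideBranchTable_inshell, sideBranchTable_feed, sideBranchTable_up1, sideBranchTable_up2] <;>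
    fin_cases i₁ <;> fin_cases i₂ <;> fin_cases i₃ <;> simp <;> norm_num

/-- **The witness lies in the table class `E₂(10)`.** [this file] -/
theorem sideBranchTable_inTableClass : InTableClass 10 sideBranchTable :=
  ⟨sideBranchTable_symmetric, sideBranchTable_cancelling, sideBranchTable_comparable⟩

/-- **The witness is an ORTHANT (Kamke) table** — the orthant hypothesis of the crux `OrthantTailCeiling`, verbatim,
via `orthant_iff_coefficients`. [this file] -/
theorem sideBranchTable_orthant :
    ∀ (Y : Fin 4 → ℤ → ℝ → ℝ) (τ : ℝ), (∀ (j : Fin 4) (k : ℤ), 1 ≤ k → 0 ≤ Y j k τ) →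
      ∀ δ : ℝ, 0 < δ → ∀ (i : Fin 4) (n : ℤ), 1 ≤ n → Y i n τ = 0 →
        0 ≤ quadTerm δ sideBranchTable Y i n τ := by
  rw [Summit.NavierStokesRegularity.NavierStokesRegularity.Theorems.orthant_iff_coefficients]
  refine ⟨?_, ?_, ?_⟩
  · intro i w
    simp only [sideBranchTable_feed, Fin.sum_univ_four]
    fin_cases i <;> simp <;> nlinarith [mul_self_nonneg (w 0), mul_self_nonneg (w 1)]
  · intro i a b hbi
    simp only [sideBranchTable_up1, sideBranchTable_up2]
    fin_cases i <;> fin_cases a <;> fin_cases b <;> simp at hbi ⊢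
  · intro i y hy hyi
    simp only [sideBranchTable_inshell, Fin.sum_univ_four]
    fin_cases i <;> simp at hyi ⊢ <;> nlinarith [mul_self_nonneg (y 0), hy 0, hy 1, hyi]

end Summit.NavierStokesRegularity.NavierStokesRegularity.Theorems.SubOnsagerCeiling

end
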